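import Summits.RiemannHypothesis.RiemannHypothesis.Theses.SignCone

/-!
# Line `Sketch` (crux idea `erasure-unit-comb-certificate`) — lead skeleton for
`SignCone.OscSingleWindow` (crux stmt-RiemannHypothesis-18012)

The crux is `∀ T ≥ 3, OscSingleWindowAt T` (pure logic, `oscSingleWindow_of_forall`, planner
Sketch). The line proves `OscSingleWindowAt T` from an ERASURE CERTIFICATE at `T`
(LANDED: `Theorems.SignCone.oscSingleWindowAt_of_erasure`, p157065; transfer from the landed
pointwise-certificate format `PWData`: `PWData.oscSingleWindowAt_of_checks`, p157668).
What remains is the existence of certificates, split by the window position: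

* `stub_slice` — windows `3 ≤ T ≤ 31/10`: ONE flat-top erasure certificate in `PWData` format
  (kernel `E_χ = 2cosh(x/2)·χ(|x|)`, `χ = 1` on `[0, 7/10] ∪ [3, 38/10]`, the LP repair bump on
  `[0.72, 2.42]`, linear collars of width `1/5`; unit comb `a_n = 2(n^{-1/2}+n^{-3/2})χ(log n)` on
  `n = 17 … 54`) whose density `PWData.F` is `≥ 0` on the whole line (numerically certified on the
  complete range `[0, 2.2·10⁵]`, kit j025029; the Lean content is the kernel check), then
  `PWData.oscSingleWindowAt_of_checks`.
* `stub_tail` — windows `T ≥ 31/10`: the research residue of the card (covering `[31/10, T₁]` by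
  further flat-top certificates is again finite computation; `T → ∞` needs a pointwise bound
  `2|Z_T(τ)| ≤ κ(τ) + O(1)` for ONE smoothed octave of `ζ(1/2+iτ)` below `τ_max(T) = exp(1.7e^{T/2})`).

`OscSingleWindow_of` composes the two stubs BY NAME into the route decl.
-/

-- `Summit.RiemannHypothesis.RiemannHypothesis.…` repeats a namespace component by design (D-0017 layout).
set_option linter.dupNamespace false

namespace Summit.RiemannHypothesis.RiemannHypothesis.Theorems.SignCone.OscSingleWindowLine

open MeasureTheory

/-- **Stub (slice).** The crux at every window position `3 ≤ T ≤ 31/10` (body verbatim over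
Mathlib primitives, every cutoff `a`): one flat-top erasure certificate pinned on `[3, 38/10] ⊇
[T, T + log 2]`, via `PWData.oscSingleWindowAt_of_checks`. -/
theorem stub_slice : ∀ T : ℝ, 3 ≤ T → T ≤ 31 / 10 →
    ∀ a : ℝ, 0 < a → ∀ (k : ℕ) (g : Fin k → ℝ → ℂ), (∀ i, (ContDiff ℝ ((⊤ : ℕ∞) : WithTop ℕ∞) (g i) ∧ HasCompactSupport (g i)) ∧ tsupport (g i) ⊆ Set.Icc (-a) a) → let F : ℝ → ℂ := fun t => ∑ i, MeasureTheory.convolution (g i) (fun u => (starRingEnd ℂ) ((g i) (-u))) (ContinuousLinearMap.mul ℂ ℂ) MeasureTheory.MeasureSpace.volume t; (∀ n : ℕ, 2 ≤ n → 0 ≤ (F (Real.log n)).re) → (∀ t : ℝ, Real.log 2 ≤ |t| → (F t).re < 0 → T ≤ |t| ∧ |t| ≤ T + Real.log 2) → (∃ t : ℝ, Real.log 2 ≤ |t| ∧ (F t).re < 0) → let M : ℂ → ℂ := fun s => ∫ u : ℝ, F u * Complex.exp ((s - 1 / 2) * u); -(F 0).re ≤ (M 0 + M 1 + ((1 / (2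 * Real.pi) : ℂ) * (∫ t : ℝ, M (1 / 2 + t * Complex.I) * ((Complex.digamma (1 / 4 + t / 2 * Complex.I)).re : ℂ)) - F 0 * (Real.log Real.pi : ℂ))).re := by
  sorry

/-- **Stub (tail).** The crux at every window position `T ≥ 31/10` (body verbatim over Mathlib
primitives, every cutoff `a`). -/
theorem stub_tail : ∀ T : ℝ, 31 / 10 ≤ T →
    ∀ a : ℝ, 0 < a → ∀ (k : ℕ) (g : Fin k → ℝ → ℂ), (∀ i, (ContDiff ℝ ((⊤ : ℕ∞) : WithTop ℕ∞) (g i) ∧ HasCompactSupport (g i)) ∧ tsupport (g i) ⊆ Set.Icc (-a) a) → let F : ℝ → ℂ := fun t => ∑ i, MeasureTheory.convolution (g i) (fun u => (starRingEnd ℂ) ((g i) (-u))) (ContinuousLinearMap.mul ℂ ℂ) MeasureTheory.MeasureSpace.volume t; (∀ n : ℕ, 2 ≤ n → 0 ≤ (F (Real.log n)).re) → (∀ t : ℝ, Real.log 2 ≤ |t| → (F t).re < 0 → T ≤ |t| ∧ |t| ≤ T + Real.log 2) → (∃ t : ℝ, Real.log 2 ≤ |t| ∧ (F t).re < 0) →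 let M : ℂ → ℂ := fun s => ∫ u : ℝ, F u * Complex.exp ((s - 1 / 2) * u); -(F 0).re ≤ (M 0 + M 1 + ((1 / (2 * Real.pi) : ℂ) * (∫ t : ℝ, M (1 / 2 + t * Complex.I) * ((Complex.digamma (1 / 4 + t / 2 * Complex.I)).re : ℂ)) - F 0 * (Real.log Real.pi : ℂ))).re := by
  sorry

/-- **Composition.** The crux `OscSingleWindow` BY NAME from the two stubs: unpack the window
`∃ T ≥ 3, …` and dispatch on `T ≤ 31/10`. -/
theorem OscSingleWindow_of :
    Summit.RiemannHypothesis.RiemannHypothesis.Theses.SignCone.OscSingleWindow := by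
  intro a ha k g hg F hn hw hosc
  obtain ⟨T, hT, hwin⟩ := hw
  by_cases hle : T ≤ 31 / 10
  · exact stub_slice T hT hle a ha k g hg hn hwin hosc
  · push Not at hle
    exact stub_tail T hle.le a ha k g hg hn hwin hosc

end Summit.RiemannHypothesis.RiemannHypothesis.Theorems.SignCone.OscSingleWindowLine
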